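import Literature.NumberTheory.Automorphic.UnitaryRankOneBorelModulusIndex
import Literature.NumberTheory.Automorphic.SatakeIsomorphismGLNormalisations
import HarnessLib

/-!
# The Satake isomorphism of the unramified `U(2)`, `U(3)` over ANY commutative ring in which the residue cardinality `q`
# (for `U(3)`), resp. `√q = q_F` (for `U(2)`), is a unit: `𝒮_{δ^{1/2}} : ℋ(U(σ, J₀), K₀; R) ⥲ R[Λ⁻]^W`
# (Cartier Thm. 4.1; Mínguez §4; the integral normalisation needs no square root of `q` for `U(3)`)

Topic `NumberTheory/Automorphic`; namespace `Literature.NumberTheory.Automorphic.HermitianLattice.UnramifiedLocalConjDatum`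
(lane `lit-hodgefound`, Track 2 foundations; seat `lit-hodgefound-p11`, generation 46, row g46-#4).  THEOREMS ONLY: no definition,
no named fact, no instance, no notation.  Companion of `UnitaryRankOneSatakeClassical` (g46-#3, the transform over `ℂ` with weights
`(√q)^{-⟨ν,·⟩}`): here the coefficient ring is an arbitrary commutative ring `R` and the weight is any homomorphism
`w : Multiplicative ℤ^N →* R` with `w(e) = u^{-e₀}` for a unit `u ∈ Rˣ` equal to `q = #𝓀[K]` (`U(3)`: `δ_B^{1/2}(t_μ) = q^{-μ₀}` is
INTEGRAL — no `√q`) resp. to `√q = Nat.sqrt q` (`U(2)`: `δ_B^{1/2}(t_μ) = q_F^{-μ₀}`, `q = q_F²` by g46-#1).  Such `w` exist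
(`exists_monoidHom_apply_ofAdd_eq_units_zpow` of `SatakeIsomorphismGLNormalisations`).  This is the form in which the unramified
Hecke algebras of unitary groups are used with `ℤ[1/q]`-, `ℤ_ℓ`- or `𝔽̄_ℓ`-coefficients.

## The mathematics

With the indices of g46-#2 (`[K_P : K_P ∩ t_μK_Pt_μ⁻¹] = q^{(2μ₀)⁺}`, `[t_μK_Pt_μ⁻¹ : K_P ∩ t_μK_Pt_μ⁻¹] = q^{(-2μ₀)⁺}` for `U(3)`;
exponents `(±μ₀)⁺` for `U(2)`) the duality of g44-#3 reads, for `U(3)` and `w(e) = u^{-e₀}`, `u = q`: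
`𝒮_w(T)_μ · u^{μ₀} · u^{(-2μ₀)⁺} = 𝒮_w(T)_{-μ} · u^{-μ₀} · u^{(2μ₀)⁺}`, and `μ₀ + (-2μ₀)⁺ = -μ₀ + (2μ₀)⁺ = |μ₀|`, so the common
unit factor `u^{|μ₀|}` cancels: **`𝒮_w(T)_{-μ} = 𝒮_w(T)_μ`** for every `T` and `μ` (`coeff_satakeTransform_neg_of_units_three`).
Conversely a `W`-invariant `g ∈ R[Λ⁻]` untwisted by `w'(e) = u^{e₀}` satisfies `f_μ = q^{2μ₀} f_{-μ}` for dominant `μ`, hence is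
`𝒮_1(T)` (g44-#9, g46-#2) and `𝒮_w(T) = g`: **`range 𝒮_w = R[Λ⁻]^W`**, **`𝒮_w` bijective onto it** (injectivity: the tree's
`satakeTransform_injective_of_commRing`).  Same for `U(2)` with `u = √q` (`(u : R)² = q`), exponents `μ₀ + 2(-μ₀)⁺ = -μ₀ + 2μ₀⁺`.

## What is formalised (theorems only)

* §1 `units_zpow_mul_pow_eq` (the exponent identity `u^a u^k = u^b u^l` for `a + k = b + l`).
* §2 (`U(3)`, `(u : R) = q`) **`coeff_satakeTransform_neg_of_units_three`**, **`range_satakeTransform_of_units_three`**,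
  **`satakeTransform_bijective_of_units_three`**, `exists_weight_neg_eval_zero` (a weight `w(e) = u^{-e₀}` exists, any `N ≥ 1`).
* §3 (`U(2)`, `(u : R) = √q`) **`coeff_satakeTransform_neg_of_units_two`**, **`range_satakeTransform_of_units_two`**,
  **`satakeTransform_bijective_of_units_two`**.

## References
* [CartierCorvallis1979] P. Cartier, *Representations of 𝔭-adic groups: a survey*, PSPM 33.1 (1979), §IV (4.2), Thm. 4.1.
* [Minguez2011] A. Mínguez, *Unramified representations of unitary groups*, in: *On the stabilization of the trace formula*
  (2011), §4.
* [Rogawski1990] J. D. Rogawski, *Automorphic Representations of Unitary Groups in Three Variables*, Ann. of Math. Stud. 123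
  (1990), §4.5 p. 50.
* [Satake1963] I. Satake, Publ. Math. IHÉS 18 (1963), §§6–7.
-/

noncomputable section

open scoped Valued WithZero Matrix MatrixGroups Pointwise
open MonoidAlgebra Representation Finset MulAction ConjAct

namespace Literature.NumberTheory.Automorphic.HermitianLattice

open Literature.NumberTheory.Automorphic.CartanUnique Literature.NumberTheory.Automorphic.SymplecticCartan
  Literature.NumberTheory.Automorphic

variable {K : Type*} [Field K] [Valued K ℤᵐ⁰] {σ : K →+* K} {ϖ : K} {R : Type*} [CommRing R]

/-! ## §1 Bookkeeping of unit powers -/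

omit [Valued K ℤᵐ⁰] in
/-- `u^{a} · u^{k} = u^{b} · u^{l}` in `R` for a unit `u` when `a + k = b + l` (`k, l ∈ ℕ`). [cite: CartierCorvallis1979, §IV (4.2)] -/
theorem units_zpow_mul_pow_eq (u : Rˣ) {a b : ℤ} {k l : ℕ} (h : a + k = b + l) :
    ((u ^ a : Rˣ) : R) * ((u : R) ^ k) = ((u ^ b : Rˣ) : R) * ((u : R) ^ l) := by
  rw [← Units.val_pow_eq_pow_val, ← Units.val_pow_eq_pow_val, ← Units.val_mul, ← Units.val_mul, ← zpow_natCast, ← zpow_natCast,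
    ← zpow_add, ← zpow_add, h]

namespace UnramifiedLocalConjDatum

/-! ## §2 `U(3)` over `R` with `q ∈ Rˣ` -/

section Three

variable [Finite 𝓀[K]]
  [IsHeckeTriple (⊤ : Submonoid (unitaryGroupOfForm σ ((StdForm.antidiagonal 3).over K))) (unitaryInt σ ((StdForm.antidiagonal 3).over K))
    (unitaryInt σ ((StdForm.antidiagonal 3).over K))]

/-- **`𝒮_w(T)_{-μ} = 𝒮_w(T)_μ` for `U(3)` over any commutative ring `R`**, for every weight `w(e) = u^{-e₀}` with `u ∈ Rˣ`,
`(u : R) = q` (`= δ_B^{1/2}` on `Λ⁻`; `σ ≠ id`): the duality of g44-#3 with the indices `q^{(∓2μ₀)⁺}` of g46-#2, the unit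
`u^{|μ₀|}` cancelled. [cite: CartierCorvallis1979, §IV (4.2), Thm. 4.1] [cite: Minguez2011, §4] -/
theorem coeff_satakeTransform_neg_of_units_three (hd : UnramifiedLocalConjDatum σ ϖ) (hσ : ∃ x : K, σ x ≠ x) (u : Rˣ)
    (hu : (u : R) = Nat.card 𝓀[K]) (w : Multiplicative (Fin 3 → ℤ) →* R)
    (hw : ∀ e : Fin 3 → ℤ, w (Multiplicative.ofAdd e) = ((u ^ (-e 0) : Rˣ) : R))
    (T : heckeAlgebra R (unitaryGroupOfForm σ ((StdForm.antidiagonal 3).over K)) (unitaryInt σ ((StdForm.antidiagonal 3).over K)))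
    (μ : Fin 3 → ℤ) :
    ((hd.isIwasawaExponent (N := 3)).satakeTransform w T).coeff (-μ) = ((hd.isIwasawaExponent (N := 3)).satakeTransform w T).coeff μ := by
  by_cases hμ : ∀ i, μ (Fin.rev i) = -μ i
  · have key := hd.coeff_satakeTransform_mul_relIndex_eq_unitary (R := R) w T hμ
    rw [hd.relIndex_borelInt_conjAct_eq_pow_three hσ hμ, hd.relIndex_conjAct_borelInt_eq_pow_three hσ hμ, hw, hw, Pi.neg_apply,
      neg_neg, Nat.cast_pow, Nat.cast_pow, ← hu, mul_assoc, mul_assoc,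
      units_zpow_mul_pow_eq u (show μ 0 + ((-(2 * μ 0)).toNat : ℤ) = -μ 0 + ((2 * μ 0).toNat : ℤ) by omega)] at key
    exact ((IsUnit.mul_left_inj ((Units.isUnit _).mul ((Units.isUnit u).pow _))).1 key).symm
  · have hμ' : ¬ ∀ i, (-μ) (Fin.rev i) = -(-μ) i := fun h => hμ fun i => by
      have := h i; rw [Pi.neg_apply, Pi.neg_apply] at this; omega
    rw [hd.coeff_satakeTransform_eq_zero_of_not_rev _ T hμ, hd.coeff_satakeTransform_eq_zero_of_not_rev _ T hμ']

/-- **`range 𝒮_w = R[Λ⁻]^W = {g : g = 0 off Λ⁻, g_{-μ} = g_μ}` for `U(3)` over `R`** (`w(e) = u^{-e₀}`, `(u : R) = q`): `⊇` by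
untwisting with `w'(e) = u^{e₀}` to `f_μ = q^{2μ₀} f_{-μ}` (dominant `μ`), g44-#9 + g46-#2. [cite: CartierCorvallis1979, §IV Thm. 4.1]
[cite: Minguez2011, §4] [cite: Rogawski1990, §4.5 p. 50] -/
theorem range_satakeTransform_of_units_three (hd : UnramifiedLocalConjDatum σ ϖ) (hσ : ∃ x : K, σ x ≠ x) (u : Rˣ)
    (hu : (u : R) = Nat.card 𝓀[K]) (w : Multiplicative (Fin 3 → ℤ) →* R)
    (hw : ∀ e : Fin 3 → ℤ, w (Multiplicative.ofAdd e) = ((u ^ (-e 0) : Rˣ) : R)) :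
    Set.range ((hd.isIwasawaExponent (N := 3)).satakeTransform w) =
      {g | (∀ μ : Fin 3 → ℤ, (¬ ∀ i, μ (Fin.rev i) = -μ i) → g.coeff μ = 0) ∧ ∀ μ : Fin 3 → ℤ, g.coeff (-μ) = g.coeff μ} := by
  ext g
  constructor
  · rintro ⟨T, rfl⟩
    exact ⟨fun _ hμ => hd.coeff_satakeTransform_eq_zero_of_not_rev _ T hμ,
      fun μ => hd.coeff_satakeTransform_neg_of_units_three hσ u hu w hw T μ⟩
  · rintro ⟨hg₁, hg₂⟩
    -- the inverse weight `w'(e) = u^{e₀}`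
    obtain ⟨w', hw'⟩ := exists_monoidHom_apply_ofAdd_eq_units_zpow (Λ := Fin 3 → ℤ) u (Pi.evalAddMonoidHom (fun _ : Fin 3 => ℤ) 0)
    have hw'e : ∀ e : Fin 3 → ℤ, w' (Multiplicative.ofAdd e) = ((u ^ e 0 : Rˣ) : R) := fun e => by rw [hw']; rfl
    have hww' : ∀ l, w l * w' l = 1 := fun l => by
      rw [← ofAdd_toAdd l, hw, hw'e, ← Units.val_mul, ← zpow_add, neg_add_cancel, zpow_zero, Units.val_one]
    set f := monomialTwist w' g with hf
    have hfV : f ∈ Set.range ((hd.isIwasawaExponent (N := 3)).satakeTransform (1 : Multiplicative (Fin 3 → ℤ) →* R)) := by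
      rw [hd.range_satakeTransform_one_unitary_three_eq_pow hσ]
      refine ⟨fun μ hμ => by rw [hf, coeff_monomialTwist, hg₁ μ hμ, mul_zero], fun μ hμ hμa => ?_⟩
      have hμ2 : μ 2 = -μ 0 := by have := hμ 0; rwa [show Fin.rev (0 : Fin 3) = 2 from by decide] at this
      have hm : 0 ≤ μ 0 := by have := hμa (show (0 : Fin 3) ≤ 2 by decide); omega
      rw [hf, coeff_monomialTwist, coeff_monomialTwist, hg₂ μ, hw'e, hw'e, Pi.neg_apply, Nat.cast_pow, ← hu, mul_right_comm,
        units_zpow_mul_pow_eq u (show -μ 0 + ((2 * μ 0).toNat : ℤ) = μ 0 + ((0 : ℕ) : ℤ) by omega), pow_zero, mul_one]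
    obtain ⟨T, hT⟩ := hfV
    refine ⟨T, ?_⟩
    rw [(hd.isIwasawaExponent (N := 3)).satakeTransform_eq_monomialTwist_comp w, AlgHom.comp_apply, hT, hf]
    exact monomialTwist_monomialTwist_of_mul_eq_one _ _ hww' g

/-- **THE SATAKE ISOMORPHISM OF THE UNRAMIFIED `U(3)` OVER `R`** (`q ∈ Rˣ`): `𝒮_w` is a bijection of `ℋ(U(σ, J₀), K₀; R)` onto
`R[Λ⁻]^W` for every weight `w(e) = u^{-e₀}`, `(u : R) = q`. [cite: CartierCorvallis1979, §IV Thm. 4.1] [cite: Minguez2011, §4]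
[cite: Satake1963, §§6–7] -/
theorem satakeTransform_bijective_of_units_three (hd : UnramifiedLocalConjDatum σ ϖ) (hσ : ∃ x : K, σ x ≠ x) (u : Rˣ)
    (hu : (u : R) = Nat.card 𝓀[K]) (w : Multiplicative (Fin 3 → ℤ) →* R)
    (hw : ∀ e : Fin 3 → ℤ, w (Multiplicative.ofAdd e) = ((u ^ (-e 0) : Rˣ) : R)) :
    Function.Bijective (fun T : heckeAlgebra R (unitaryGroupOfForm σ ((StdForm.antidiagonal 3).over K))
        (unitaryInt σ ((StdForm.antidiagonal 3).over K)) =>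
      (⟨(hd.isIwasawaExponent (N := 3)).satakeTransform w T, ⟨fun _ hμ => hd.coeff_satakeTransform_eq_zero_of_not_rev _ T hμ,
        fun μ => hd.coeff_satakeTransform_neg_of_units_three hσ u hu w hw T μ⟩⟩ :
        {g : AddMonoidAlgebra R (Fin 3 → ℤ) //
          (∀ μ : Fin 3 → ℤ, (¬ ∀ i, μ (Fin.rev i) = -μ i) → g.coeff μ = 0) ∧ ∀ μ : Fin 3 → ℤ, g.coeff (-μ) = g.coeff μ})) := by
  refine ⟨fun T T' h => hd.satakeTransform_injective_of_commRing w (congrArg Subtype.val h), fun g => ?_⟩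
  have hg : (g : AddMonoidAlgebra R (Fin 3 → ℤ)) ∈ Set.range ((hd.isIwasawaExponent (N := 3)).satakeTransform w) := by
    rw [hd.range_satakeTransform_of_units_three hσ u hu w hw]
    exact g.2
  obtain ⟨T, hT⟩ := hg
  exact ⟨T, Subtype.ext hT⟩

omit [Valued K ℤᵐ⁰] [Finite 𝓀[K]]
  [IsHeckeTriple (⊤ : Submonoid (unitaryGroupOfForm σ ((StdForm.antidiagonal 3).over K))) (unitaryInt σ ((StdForm.antidiagonal 3).over K))
    (unitaryInt σ ((StdForm.antidiagonal 3).over K))] in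
/-- A weight `w(e) = u^{-e₀}` exists for every unit `u` (any `N ≥ 1`). [cite: CartierCorvallis1979, §IV (4.2)] -/
theorem exists_weight_neg_eval_zero {N : ℕ} [NeZero N] (u : Rˣ) :
    ∃ w : Multiplicative (Fin N → ℤ) →* R, ∀ e : Fin N → ℤ, w (Multiplicative.ofAdd e) = ((u ^ (-e 0) : Rˣ) : R) := by
  obtain ⟨w, hw⟩ := exists_monoidHom_apply_ofAdd_eq_units_zpow (Λ := Fin N → ℤ) u (-Pi.evalAddMonoidHom (fun _ : Fin N => ℤ) 0)
  exact ⟨w, fun e => by rw [hw]; rfl⟩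

end Three

/-! ## §3 `U(2)` over `R` with `√q ∈ Rˣ` -/

section Two

variable [Finite 𝓀[K]]
  [IsHeckeTriple (⊤ : Submonoid (unitaryGroupOfForm σ ((StdForm.antidiagonal 2).over K))) (unitaryInt σ ((StdForm.antidiagonal 2).over K))
    (unitaryInt σ ((StdForm.antidiagonal 2).over K))]

/-- **`𝒮_w(T)_{-μ} = 𝒮_w(T)_μ` for `U(2)` over any commutative ring `R`**, for every weight `w(e) = u^{-e₀}` with `u ∈ Rˣ`,
`(u : R) = √q = Nat.sqrt q` (`= q_F`; `(u : R)² = q` by g46-#1). [cite: CartierCorvallis1979, §IV (4.2), Thm. 4.1] [cite: Minguez2011, §4] -/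
theorem coeff_satakeTransform_neg_of_units_two (hd : UnramifiedLocalConjDatum σ ϖ) (hσ : ∃ x : K, σ x ≠ x) (u : Rˣ)
    (hu : (u : R) = Nat.sqrt (Nat.card 𝓀[K])) (w : Multiplicative (Fin 2 → ℤ) →* R)
    (hw : ∀ e : Fin 2 → ℤ, w (Multiplicative.ofAdd e) = ((u ^ (-e 0) : Rˣ) : R))
    (T : heckeAlgebra R (unitaryGroupOfForm σ ((StdForm.antidiagonal 2).over K)) (unitaryInt σ ((StdForm.antidiagonal 2).over K)))
    (μ : Fin 2 → ℤ) :
    ((hd.isIwasawaExponent (N := 2)).satakeTransform w T).coeff (-μ) = ((hd.isIwasawaExponent (N := 2)).satakeTransform w T).coeff μ := by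
  have hq : (Nat.card 𝓀[K] : R) = (u : R) ^ 2 := by
    rw [hu, ← Nat.cast_pow, sq, hd.sqrt_card_residueField_mul_self hσ]
  by_cases hμ : ∀ i, μ (Fin.rev i) = -μ i
  · have key := hd.coeff_satakeTransform_mul_relIndex_eq_unitary (R := R) w T hμ
    rw [hd.relIndex_borelInt_conjAct_eq_pow_two hσ hμ, hd.relIndex_conjAct_borelInt_eq_pow_two hσ hμ, hw, hw, Pi.neg_apply,
      neg_neg, Nat.cast_pow, Nat.cast_pow, hq, ← pow_mul, ← pow_mul, mul_assoc, mul_assoc,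
      units_zpow_mul_pow_eq u (show μ 0 + ((2 * (-μ 0).toNat : ℕ) : ℤ) = -μ 0 + ((2 * (μ 0).toNat : ℕ) : ℤ) by omega)] at key
    exact ((IsUnit.mul_left_inj ((Units.isUnit _).mul ((Units.isUnit u).pow _))).1 key).symm
  · have hμ' : ¬ ∀ i, (-μ) (Fin.rev i) = -(-μ) i := fun h => hμ fun i => by
      have := h i; rw [Pi.neg_apply, Pi.neg_apply] at this; omega
    rw [hd.coeff_satakeTransform_eq_zero_of_not_rev _ T hμ, hd.coeff_satakeTransform_eq_zero_of_not_rev _ T hμ']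

/-- **`range 𝒮_w = R[Λ⁻]^W` for `U(2)` over `R`** (`w(e) = u^{-e₀}`, `(u : R) = √q`). [cite: CartierCorvallis1979, §IV Thm. 4.1]
[cite: Minguez2011, §4] [cite: Rogawski1990, §4.5 p. 50] -/
theorem range_satakeTransform_of_units_two (hd : UnramifiedLocalConjDatum σ ϖ) (hσ : ∃ x : K, σ x ≠ x) (u : Rˣ)
    (hu : (u : R) = Nat.sqrt (Nat.card 𝓀[K])) (w : Multiplicative (Fin 2 → ℤ) →* R)
    (hw : ∀ e : Fin 2 → ℤ, w (Multiplicative.ofAdd e) = ((u ^ (-e 0) : Rˣ) : R)) :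
    Set.range ((hd.isIwasawaExponent (N := 2)).satakeTransform w) =
      {g | (∀ μ : Fin 2 → ℤ, (¬ ∀ i, μ (Fin.rev i) = -μ i) → g.coeff μ = 0) ∧ ∀ μ : Fin 2 → ℤ, g.coeff (-μ) = g.coeff μ} := by
  have hq : (Nat.card 𝓀[K] : R) = (u : R) ^ 2 := by
    rw [hu, ← Nat.cast_pow, sq, hd.sqrt_card_residueField_mul_self hσ]
  ext g
  constructor
  · rintro ⟨T, rfl⟩
    exact ⟨fun _ hμ => hd.coeff_satakeTransform_eq_zero_of_not_rev _ T hμ,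
      fun μ => hd.coeff_satakeTransform_neg_of_units_two hσ u hu w hw T μ⟩
  · rintro ⟨hg₁, hg₂⟩
    obtain ⟨w', hw'⟩ := exists_monoidHom_apply_ofAdd_eq_units_zpow (Λ := Fin 2 → ℤ) u (Pi.evalAddMonoidHom (fun _ : Fin 2 => ℤ) 0)
    have hw'e : ∀ e : Fin 2 → ℤ, w' (Multiplicative.ofAdd e) = ((u ^ e 0 : Rˣ) : R) := fun e => by rw [hw']; rfl
    have hww' : ∀ l, w l * w' l = 1 := fun l => by
      rw [← ofAdd_toAdd l, hw, hw'e, ← Units.val_mul, ← zpow_add, neg_add_cancel, zpow_zero, Units.val_one]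
    set f := monomialTwist w' g with hf
    have hfV : f ∈ Set.range ((hd.isIwasawaExponent (N := 2)).satakeTransform (1 : Multiplicative (Fin 2 → ℤ) →* R)) := by
      rw [hd.range_satakeTransform_one_unitary_two_eq_pow hσ]
      refine ⟨fun μ hμ => by rw [hf, coeff_monomialTwist, hg₁ μ hμ, mul_zero], fun μ hμ hμa => ?_⟩
      have hμ1 : μ 1 = -μ 0 := by have := hμ 0; rwa [show Fin.rev (0 : Fin 2) = 1 from by decide] at this
      have hm : 0 ≤ μ 0 := by have := hμa (show (0 : Fin 2) ≤ 1 by decide); omega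
      rw [hf, coeff_monomialTwist, coeff_monomialTwist, hg₂ μ, hw'e, hw'e, Pi.neg_apply, Nat.cast_pow, hq, ← pow_mul, mul_right_comm,
        units_zpow_mul_pow_eq u (show -μ 0 + ((2 * (μ 0).toNat : ℕ) : ℤ) = μ 0 + ((0 : ℕ) : ℤ) by omega), pow_zero, mul_one]
    obtain ⟨T, hT⟩ := hfV
    refine ⟨T, ?_⟩
    rw [(hd.isIwasawaExponent (N := 2)).satakeTransform_eq_monomialTwist_comp w, AlgHom.comp_apply, hT, hf]
    exact monomialTwist_monomialTwist_of_mul_eq_one _ _ hww' g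

/-- **THE SATAKE ISOMORPHISM OF THE UNRAMIFIED `U(2)` OVER `R`** (`√q ∈ Rˣ`): `𝒮_w` is a bijection of `ℋ(U(σ, J₀), K₀; R)`
onto `R[Λ⁻]^W`, `w(e) = u^{-e₀}`, `(u : R) = √q`. [cite: CartierCorvallis1979, §IV Thm. 4.1] [cite: Minguez2011, §4]
[cite: Satake1963, §§6–7] -/
theorem satakeTransform_bijective_of_units_two (hd : UnramifiedLocalConjDatum σ ϖ) (hσ : ∃ x : K, σ x ≠ x) (u : Rˣ)
    (hu : (u : R) = Nat.sqrt (Nat.card 𝓀[K])) (w : Multiplicative (Fin 2 → ℤ) →* R)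
    (hw : ∀ e : Fin 2 → ℤ, w (Multiplicative.ofAdd e) = ((u ^ (-e 0) : Rˣ) : R)) :
    Function.Bijective (fun T : heckeAlgebra R (unitaryGroupOfForm σ ((StdForm.antidiagonal 2).over K))
        (unitaryInt σ ((StdForm.antidiagonal 2).over K)) =>
      (⟨(hd.isIwasawaExponent (N := 2)).satakeTransform w T, ⟨fun _ hμ => hd.coeff_satakeTransform_eq_zero_of_not_rev _ T hμ,
        fun μ => hd.coeff_satakeTransform_neg_of_units_two hσ u hu w hw T μ⟩⟩ :
        {g : AddMonoidAlgebra R (Fin 2 → ℤ) //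
          (∀ μ : Fin 2 → ℤ, (¬ ∀ i, μ (Fin.rev i) = -μ i) → g.coeff μ = 0) ∧ ∀ μ : Fin 2 → ℤ, g.coeff (-μ) = g.coeff μ})) := by
  refine ⟨fun T T' h => hd.satakeTransform_injective_of_commRing w (congrArg Subtype.val h), fun g => ?_⟩
  have hg : (g : AddMonoidAlgebra R (Fin 2 → ℤ)) ∈ Set.range ((hd.isIwasawaExponent (N := 2)).satakeTransform w) := by
    rw [hd.range_satakeTransform_of_units_two hσ u hu w hw]
    exact g.2
  obtain ⟨T, hT⟩ := hg
  exact ⟨T, Subtype.ext hT⟩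

end Two

end UnramifiedLocalConjDatum

end Literature.NumberTheory.Automorphic.HermitianLattice

end
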